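import Summits.QuantumFields.BalabanUV.Beta.GAN24.ContactCellRefineFaces

/-!
# `BalabanUV.Beta.GAN24.ContactCellRefineTip` — binder row G-an2-4 / (CONV-C), the row owner's CONTACT-TERM ROUTE, **CT-4c** (`gen19/CT4-DESIGN-v0.md` §3
# «`ContactCellRefine` … Owner or leaf-02»), PART 3: **THE TWO-TOWER DIFFERENCE OF THE TWO MAXWELL PAIRINGS OF `cell_eq` WITH THEIR TIP ∕ MIDPOINT GAUGE
# WEIGHTS — PART 1's «one differenced ingredient» PLUS THE REALIGNMENT OF THE SHORTER TOWER'S WEIGHT.**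

NOT IN PRINT; OUR BOOKKEEPING (G-an2-4 formalisation swarm, leaf prover `b2b-balaban-gan24-formalise-leaf-02`, gen 50; «MINE (CT-4c)» journal `CLAIMS.log`
l.35439; re-cut after leaf-01 g61's W-leaf01-g61-3 l.35569 and gan24-p2 g34's «MINE (CT-4c-P)» l.35579 — the GRADIENT-SLOT (pairing) half of CT-4c is p2's
`ContactTentFaceAvg` ∕ `ContactRefineP` by exact far-face transport; journal W-leaf02-g50-2 l.≈35600).  HONEST FRAMING (cell contract, verbatim): «discharging
`BetaPertH` makes Bałaban's UV stability UNCONDITIONAL — a real constructive-QFT result; it is NOT the continuum limit and NOT the Clay problem.»  HONEST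
DEPENDENCY (verbatim): «continuum YM on T⁴ ⇐ BetaPertH ∧ nine spine estimates (0/9 proved); BetaPertH ⇐ (D1) ∧ (D4) ∧ CAP+tail; G-an2-4 gates asym,
D1 and NE2/3/4.»

WHAT (generic `d`; 0 `def`, 0 cited fact, 0 `def … : Prop`, 0 sorry; [folklore] bookkeeping BY NAME over PARTs 1–2 and leaf-02's `ContactOneGaugeCellBound`).
* **`abs_refine3_tip_le`** — the first pairing of my lineage's `cell_eq` (`Σ'_u Σ_κ ψ(u+e_κ)·T κ u·M κ u`, the UNDRESSED part `B` of the partner in the `T` slot; the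
  dressed part `dλ` is gan24-p2's CT-4c-P): fine′ data `ψ′ T′ M′` (blocking `N′ = L·N`) against tower-`k` data `ψ T M` (blocking `N`) with block envelopes
  `Eψ E₁ E₃`, the POINTWISE letters `|T′ κ x − T κ (quo L x)| ≤ ε₁·E_{z₁}` ((β): leaf-01 g61's `RespStepRefine`), `|M′ − M̃| ≤ ε₃·E_{z₃}` ((γ): p2's
  `ContactTentRefine`), the SITE gauge letter `|ψ′ x − ψ(quo L x)| ≤ εψ·E_{z₀}` ((α)+(δ) summed: CT-4b), and `ψ` a STAIRCASE `Σ_{s<k+1} G s ∘ blk (P s)` with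
  per-scale envelopes `a s` (`P s ∣ N`):
  `|(N′^{d+1})⁻¹·Σ'_x Σ_κ ψ′(x+e_κ)·T′κx·M′κx − (N^{d+1})⁻¹·Σ'_c Σ_κ ψ(c+e_κ)·Tκc·Mκc|`
  `≤ (d+1)·[e^{κ₀}·(Eψ·ε₁·E₃ + Eψ·E₁·ε₃ + εψ·E₁·E₃) + 2e^{κ₀}·(Σ_{s<k+1} a s·(P s)⁻¹)·E₁·E₃]·Zl(d+1)(κ₀∕(4(d+1)))·e^{−(κ₀∕12)(‖z₁−z₀‖∞+‖z₃−z₀‖∞)}`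
  — the last summand is the REALIGNMENT: by PART 2 the defect `ψ(quo L (x+e_κ)) − ψ(quo L x + e_κ)` paired with `T̃M̃` is the tower-`k` quantity
  `−(L^{d+1} − L^d)·Σ'_c Σ_κ (ψ(c+e_κ) − ψ c)·Tκc·Mκc`, a staircase jump against two smooth factors (PART 1's `abs_tsum_mul_jump_staircase_le`); with the unit
  amplitudes `a s = α·Lc^s∕N` at `P s = Lc^s` its weight is `α(k+1)∕N` — relatively `O((k+1)∕N)`.
* **`abs_refine3_mid_le`** — the second pairing (midpoint weights `½(ψ z + ψ(z+e_β))`): half SITE (PART 1, no realignment) + half TIP; same bound.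
Discharges NOTHING of hSdev by itself (CT-4e composes, cell by cell of leaf-01's `contact_legChain_ff_eq_cells`); 0 wall binders; NEVER «G-an2-4 closed» as
(CONV-C); NOT D1, NOT BetaPertH, NOT continuum, NOT Clay.
-/

noncomputable section

open Finset
open scoped BigOperators
open Literature.MathematicalPhysics.QuantumFieldTheory
open Literature.MathematicalPhysics.QuantumFieldTheory.LatticeForm (quo)
open Literature.MathematicalPhysics.QuantumFieldTheory.Balaban1983to89
open Literature.MathematicalPhysics.QuantumFieldTheory.Balaban1983to89.Beta
open B4ContourShift (supNorm supNorm_nonneg)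
open ExpKernelCalculus (Zl Zl_nonneg)
open AffineAveraging (Form0 Form1 Site box toSite)
open AveragingContours (blk)
open B6BondElimination (unitVec unitVec_apply)
open Summit.QuantumFields.BalabanUV.Beta.GAN24.EnvelopeBlockSum (env_le_one summable_env)
open Summit.QuantumFields.BalabanUV.Beta.GAN24.StaircaseFaces (blk_add_unitVec_of_not_dvd tsum_ite_dvd_eq quo_quo quo_zsmul_add_toSite_of_dvd)
open Summit.QuantumFields.BalabanUV.Beta.GAN24.ContactOneGaugeCellBound (tsum_env3_le abs_tsum_weight_mul_mul_le abs_tip_weight_le abs_mid_weight_le)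
open Summit.QuantumFields.BalabanUV.Beta.GAN24.ContactCellRefine (quo_quo' units_refine tsum_comp_quo' summable_comp_quo' abs_refine3_le
  abs_tsum_mul_jump_staircase_le)

open Summit.QuantumFields.BalabanUV.Beta.GAN24.ContactCellRefineFaces (summable_mul_jump_of_env abs_staircase_le tsum_comp_quo_mul_jump_eq)

namespace Summit.QuantumFields.BalabanUV.Beta.GAN24.ContactCellRefineTip

variable {d : ℕ}

/-! ## The tip and midpoint weights: the realignment -/

section Tip

variable {L N N' k : ℕ} {κ₀ : ℝ} {ψ' ψ : Form0 (d + 1) ℝ} {T' M' T M : Form1 (d + 1) ℝ} {G : ℕ → Form0 (d + 1) ℝ} {a : ℕ → ℝ} {P : ℕ → ℕ}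
  {z₀ z₁ z₃ : Site (d + 1)} {Eψ E₁ E₃ εψ ε₁ ε₃ : ℝ}
set_option maxHeartbeats 400000 in
/-- NOT IN PRINT; OUR BOOKKEEPING.  **THE TWO-TOWER DIFFERENCE OF A MAXWELL PAIRING WITH TIP WEIGHTS** (the first pairing of my lineage's `cell_eq`:
`Σ'_u Σ_κ ψ(u + e_κ)·T κ u·M κ u`): PART 1's three pointwise terms (gauge SITE letter `εψ`, partner letter `ε₁`, tent letter `ε₃`; the tip weights cost one
`e^{κ₀}`) PLUS THE REALIGNMENT — the tip of the tower-`k` gauge function read through the cell map, `ψ(quo L x + e_κ)`, against the aligned `ψ(quo L (x + e_κ))`: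
by §1–§2 their difference paired with `T̃M̃` is the tower-`k` quantity `−(L^{d+1} − L^d)·Σ'_c Σ_κ (ψ(c + e_κ) − ψ c)·T κ c·M κ c`, a STAIRCASE JUMP against the two
smooth factors, counted by PART 1's `abs_tsum_mul_jump_staircase_le` (weight `Σ_s a s·(P s)⁻¹`; with `a s = α·Lc^s∕N`, `P s = Lc^s`: `α(k+1)∕N` — relatively
`O((k+1)∕N)`):
`|(N′^{d+1})⁻¹·Σ'_x Σ_κ ψ′(x+e_κ)·T′M′ − (N^{d+1})⁻¹·Σ'_c Σ_κ ψ(c+e_κ)·T M|`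
`≤ (d+1)·[e^{κ₀}·(Eψ·ε₁·E₃ + Eψ·E₁·ε₃ + εψ·E₁·E₃) + 2e^{κ₀}·(Σ_{s<k+1} a s·(P s)⁻¹)·E₁·E₃]·Zl(d+1)(κ₀∕(4(d+1)))·e^{−(κ₀∕12)(‖z₁−z₀‖∞+‖z₃−z₀‖∞)}`. -/
theorem abs_refine3_tip_le (hL : 1 ≤ L) (hN : 1 ≤ N) (hN' : N' = L * N) (hκ : 0 < κ₀)
    (hEψ : 0 ≤ Eψ) (hE₁ : 0 ≤ E₁) (hE₃ : 0 ≤ E₃) (hεψ : 0 ≤ εψ) (hε₁ : 0 ≤ ε₁) (hε₃ : 0 ≤ ε₃) (ha : ∀ s, 0 ≤ a s)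
    (hP : ∀ s, s ≤ k → 1 ≤ P s) (hPN : ∀ s, s ≤ k → P s ∣ N)
    (hψ' : ∀ x, |ψ' x| ≤ Eψ * Real.exp (-(κ₀ * supNorm (quo N' x - z₀))))
    (hψ : ∀ c, |ψ c| ≤ Eψ * Real.exp (-(κ₀ * supNorm (quo N c - z₀))))
    (hG : ∀ s, s ≤ k → ∀ c, |G s (blk (P s) c)| ≤ a s * Real.exp (-(κ₀ * supNorm (quo N c - z₀))))
    (hψG : ∀ c, ψ c = ∑ s ∈ Finset.range (k + 1), G s (blk (P s) c))
    (hM' : ∀ κ x, |M' κ x| ≤ E₃ * Real.exp (-(κ₀ * supNorm (quo N' x - z₃))))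
    (hT : ∀ κ c, |T κ c| ≤ E₁ * Real.exp (-(κ₀ * supNorm (quo N c - z₁))))
    (hM : ∀ κ c, |M κ c| ≤ E₃ * Real.exp (-(κ₀ * supNorm (quo N c - z₃))))
    (hdT : ∀ κ x, |T' κ x - T κ (quo L x)| ≤ ε₁ * Real.exp (-(κ₀ * supNorm (quo N' x - z₁))))
    (hdM : ∀ κ x, |M' κ x - M κ (quo L x)| ≤ ε₃ * Real.exp (-(κ₀ * supNorm (quo N' x - z₃))))
    (hdψ : ∀ x, |ψ' x - ψ (quo L x)| ≤ εψ * Real.exp (-(κ₀ * supNorm (quo N' x - z₀)))) :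
    (Summable fun x : Site (d + 1) => ∑ κ, ψ' (x + unitVec κ) * T' κ x * M' κ x) ∧
    (Summable fun c : Site (d + 1) => ∑ κ, ψ (c + unitVec κ) * T κ c * M κ c) ∧
    |((N' : ℝ) ^ (d + 1))⁻¹ * ∑' x : Site (d + 1), ∑ κ, ψ' (x + unitVec κ) * T' κ x * M' κ x -
        ((N : ℝ) ^ (d + 1))⁻¹ * ∑' c : Site (d + 1), ∑ κ, ψ (c + unitVec κ) * T κ c * M κ c| ≤
      ((d : ℝ) + 1) * (Real.exp κ₀ * (Eψ * ε₁ * E₃ + Eψ * E₁ * ε₃ + εψ * E₁ * E₃)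
          + 2 * Real.exp κ₀ * (∑ s ∈ Finset.range (k + 1), a s * ((P s : ℝ))⁻¹) * (E₁ * E₃)) *
        (Zl (d + 1) (κ₀ / (4 * ((d : ℝ) + 1))) * Real.exp (-(κ₀ / 12) * (supNorm (z₁ - z₀) + supNorm (z₃ - z₀)))) := by
  have hN'1 : 1 ≤ N' := by rw [hN']; exact Nat.le_mul_of_pos_right L hN |>.trans' hL
  have hκ' : 0 ≤ κ₀ := hκ.le
  have hq : ∀ x : Site (d + 1), quo N (quo L x) = quo N' x := fun x => quo_quo' hN' x
  -- envelopes read on fine′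
  have hψq : ∀ x : Site (d + 1), |ψ (quo L x)| ≤ Eψ * Real.exp (-(κ₀ * supNorm (quo N' x - z₀))) := fun x => by
    have h := hψ (quo L x); rwa [hq] at h
  have hTq : ∀ κ x, |T κ (quo L x)| ≤ E₁ * Real.exp (-(κ₀ * supNorm (quo N' x - z₁))) := fun κ x => by
    have h := hT κ (quo L x); rwa [hq] at h
  have hMq : ∀ κ x, |M κ (quo L x)| ≤ E₃ * Real.exp (-(κ₀ * supNorm (quo N' x - z₃))) := fun κ x => by
    have h := hM κ (quo L x); rwa [hq] at h
  -- the tip weights (one `e^{κ₀}` each)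
  have hW' : ∀ κ x, |ψ' (x + unitVec κ)| ≤ Eψ * Real.exp κ₀ * Real.exp (-(κ₀ * supNorm (quo N' x - z₀))) :=
    fun κ x => abs_tip_weight_le hN'1 hκ' hEψ hψ' κ x
  have hdW : ∀ κ x, |ψ' (x + unitVec κ) - ψ (quo L (x + unitVec κ))| ≤ εψ * Real.exp κ₀ * Real.exp (-(κ₀ * supNorm (quo N' x - z₀))) :=
    fun κ x => abs_tip_weight_le (ψ := fun x => ψ' x - ψ (quo L x)) hN'1 hκ' hεψ hdψ κ x
  have hW : ∀ κ c, |ψ (c + unitVec κ)| ≤ Eψ * Real.exp κ₀ * Real.exp (-(κ₀ * supNorm (quo N c - z₀))) :=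
    fun κ c => abs_tip_weight_le hN hκ' hEψ hψ κ c
  have hEψ' : 0 ≤ Eψ * Real.exp κ₀ := by positivity
  have hεψ' : 0 ≤ εψ * Real.exp κ₀ := by positivity
  -- the three pointwise terms
  obtain ⟨hsA, hA⟩ := abs_tsum_weight_mul_mul_le (d := d) hN'1 hκ (w := fun κ x => ψ' (x + unitVec κ)) (T := fun κ x => T' κ x - T κ (quo L x))
    (M := M') (z₀ := z₀) (z₁ := z₁) (z₃ := z₃) hEψ' hε₁ hE₃ hW' hdT hM'
  obtain ⟨hsB, hB⟩ := abs_tsum_weight_mul_mul_le (d := d) hN'1 hκ (w := fun κ x => ψ' (x + unitVec κ)) (T := fun κ x => T κ (quo L x))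
    (M := fun κ x => M' κ x - M κ (quo L x)) (z₀ := z₀) (z₁ := z₁) (z₃ := z₃) hEψ' hE₁ hε₃ hW' hTq hdM
  obtain ⟨hsC, hC⟩ := abs_tsum_weight_mul_mul_le (d := d) hN'1 hκ (w := fun κ x => ψ' (x + unitVec κ) - ψ (quo L (x + unitVec κ)))
    (T := fun κ x => T κ (quo L x)) (M := fun κ x => M κ (quo L x)) (z₀ := z₀) (z₁ := z₁) (z₃ := z₃) hεψ' hE₁ hE₃ hdW hTq hMq
  -- the tower-k pairing and its reading
  obtain ⟨hsP, -⟩ := abs_tsum_weight_mul_mul_le (d := d) hN hκ (w := fun κ c => ψ (c + unitVec κ)) (T := T) (M := M)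
    (z₀ := z₀) (z₁ := z₁) (z₃ := z₃) hEψ' hE₁ hE₃ hW hT hM
  have hsPq : Summable fun x : Site (d + 1) => ∑ κ, ψ (quo L x + unitVec κ) * T κ (quo L x) * M κ (quo L x) :=
    summable_comp_quo' (g := fun c => ∑ κ, ψ (c + unitVec κ) * T κ c * M κ c) hL hsP
  have hread : ((N' : ℝ) ^ (d + 1))⁻¹ * ∑' x : Site (d + 1), ∑ κ, ψ (quo L x + unitVec κ) * T κ (quo L x) * M κ (quo L x)
      = ((N : ℝ) ^ (d + 1))⁻¹ * ∑' c : Site (d + 1), ∑ κ, ψ (c + unitVec κ) * T κ c * M κ c :=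
    units_refine (g := fun c => ∑ κ, ψ (c + unitVec κ) * T κ c * M κ c) hL hN hN' hsP
  -- the realignment: Φ := T·M against the jump of ψ
  have hΦ : ∀ κ c, |T κ c * M κ c| ≤ E₁ * E₃ * (Real.exp (-(κ₀ * supNorm (quo N c - z₁))) * Real.exp (-(κ₀ * supNorm (quo N c - z₃)))) := by
    intro κ c
    rw [abs_mul]
    have h1 := hT κ c; have h2 := hM κ c
    calc |T κ c| * |M κ c| ≤ (E₁ * Real.exp (-(κ₀ * supNorm (quo N c - z₁)))) * (E₃ * Real.exp (-(κ₀ * supNorm (quo N c - z₃)))) :=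
          mul_le_mul h1 h2 (abs_nonneg _) (by positivity)
      _ = _ := by ring
  have hψb : ∀ c, |ψ c| ≤ ∑ s ∈ Finset.range (k + 1), a s := abs_staircase_le (N := N) hκ' hG hψG ha
  have hsJ : ∀ κ, Summable fun c : Site (d + 1) => T κ c * M κ c * (ψ (c + unitVec κ) - ψ c) := fun κ =>
    summable_mul_jump_of_env (Φ := fun κ c => T κ c * M κ c) (h := ψ) hN hκ (mul_nonneg hE₁ hE₃) hΦ hψb κ (unitVec κ)
  have hface := fun κ => tsum_comp_quo_mul_jump_eq hL (fun κ c => T κ c * M κ c) ψ κ (hsJ κ)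
  obtain ⟨hsX, hX⟩ := abs_tsum_mul_jump_staircase_le (N := N) (z₀ := z₀) (z₁ := z₁) (z₃ := z₃) hN hκ hP hPN
    (Φ := fun κ c => T κ c * M κ c) (G := G) (a := a) (mul_nonneg hE₁ hE₃) ha hΦ hG hψG
  set X : ℝ := ∑' c : Site (d + 1), ∑ κ, T κ c * M κ c * (ψ (c + unitVec κ) - ψ c) with hXdef
  -- the realignment summand and its two cell sums
  have hsD1 : Summable fun x : Site (d + 1) => ∑ κ, T κ (quo L x) * M κ (quo L x) * (ψ (quo L (x + unitVec κ)) - ψ (quo L x)) :=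
    summable_sum fun κ _ => (hface κ).1
  have hsD2 : Summable fun x : Site (d + 1) => ∑ κ, T κ (quo L x) * M κ (quo L x) * (ψ (quo L x + unitVec κ) - ψ (quo L x)) :=
    summable_comp_quo' (g := fun c => ∑ κ, T κ c * M κ c * (ψ (c + unitVec κ) - ψ c)) hL hsX
  have hD1 : ∑' x : Site (d + 1), ∑ κ, T κ (quo L x) * M κ (quo L x) * (ψ (quo L (x + unitVec κ)) - ψ (quo L x)) = (L : ℝ) ^ d * X := by
    rw [Summable.tsum_finsetSum fun κ _ => (hface κ).1, hXdef, Summable.tsum_finsetSum fun κ _ => hsJ κ, Finset.mul_sum]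
    exact Finset.sum_congr rfl fun κ _ => (hface κ).2
  have hD2 : ∑' x : Site (d + 1), ∑ κ, T κ (quo L x) * M κ (quo L x) * (ψ (quo L x + unitVec κ) - ψ (quo L x)) = (L : ℝ) ^ (d + 1) * X :=
    tsum_comp_quo' (g := fun c => ∑ κ, T κ c * M κ c * (ψ (c + unitVec κ) - ψ c)) hL hsX
  -- the pointwise split: three one-difference terms, the realignment, the reading of the tower-k pairing
  have hsplit : ∀ x : Site (d + 1), ∑ κ, ψ' (x + unitVec κ) * T' κ x * M' κ x =
      (((∑ κ, ψ' (x + unitVec κ) * (T' κ x - T κ (quo L x)) * M' κ x)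
        + ∑ κ, ψ' (x + unitVec κ) * T κ (quo L x) * (M' κ x - M κ (quo L x)))
        + ∑ κ, (ψ' (x + unitVec κ) - ψ (quo L (x + unitVec κ))) * T κ (quo L x) * M κ (quo L x))
        + ((∑ κ, T κ (quo L x) * M κ (quo L x) * (ψ (quo L (x + unitVec κ)) - ψ (quo L x)))
          - ∑ κ, T κ (quo L x) * M κ (quo L x) * (ψ (quo L x + unitVec κ) - ψ (quo L x)))
        + ∑ κ, ψ (quo L x + unitVec κ) * T κ (quo L x) * M κ (quo L x) := by
    intro x
    rw [← Finset.sum_add_distrib, ← Finset.sum_add_distrib, ← Finset.sum_sub_distrib, ← Finset.sum_add_distrib, ← Finset.sum_add_distrib]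
    exact Finset.sum_congr rfl fun κ _ => by ring
  have hsF : Summable fun x : Site (d + 1) => ∑ κ, ψ' (x + unitVec κ) * T' κ x * M' κ x :=
    (((((hsA.add hsB).add hsC).add (hsD1.sub hsD2)).add hsPq)).congr fun x => (hsplit x).symm
  refine ⟨hsF, hsP, ?_⟩
  set A : ℝ := ∑' x : Site (d + 1), ∑ κ, ψ' (x + unitVec κ) * (T' κ x - T κ (quo L x)) * M' κ x with hAdef
  set B : ℝ := ∑' x : Site (d + 1), ∑ κ, ψ' (x + unitVec κ) * T κ (quo L x) * (M' κ x - M κ (quo L x)) with hBdef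
  set C : ℝ := ∑' x : Site (d + 1), ∑ κ, (ψ' (x + unitVec κ) - ψ (quo L (x + unitVec κ))) * T κ (quo L x) * M κ (quo L x) with hCdef
  set Pq : ℝ := ∑' x : Site (d + 1), ∑ κ, ψ (quo L x + unitVec κ) * T κ (quo L x) * M κ (quo L x) with hPqdef
  set ZE : ℝ := Zl (d + 1) (κ₀ / (4 * ((d : ℝ) + 1))) * Real.exp (-(κ₀ / 12) * (supNorm (z₁ - z₀) + supNorm (z₃ - z₀))) with hZE
  have htsum : ∑' x : Site (d + 1), ∑ κ, ψ' (x + unitVec κ) * T' κ x * M' κ x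
      = A + B + C + (((L : ℝ) ^ d * X) - (L : ℝ) ^ (d + 1) * X) + Pq := by
    rw [tsum_congr hsplit, ((((hsA.add hsB).add hsC).add (hsD1.sub hsD2)).tsum_add hsPq), (((hsA.add hsB).add hsC).tsum_add (hsD1.sub hsD2)),
      ((hsA.add hsB).tsum_add hsC), hsA.tsum_add hsB, hsD1.tsum_sub hsD2, hD1, hD2]
  have hN'pos : (0 : ℝ) < (N' : ℝ) := by exact_mod_cast (show 0 < N' by omega)
  have hL1 : (1 : ℝ) ≤ (L : ℝ) := by exact_mod_cast hL
  have hpow : ((N' : ℝ) ^ (d + 1)) = (L : ℝ) ^ (d + 1) * (N : ℝ) ^ (d + 1) := by rw [hN']; push_cast; rw [mul_pow]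
  set r : ℝ := ((N' : ℝ) ^ (d + 1))⁻¹ with hr
  have hr0 : 0 ≤ r := by positivity
  have hrN' : r * (N' : ℝ) ^ (d + 1) = 1 := inv_mul_cancel₀ (by positivity)
  have e : r * (A + B + C + (((L : ℝ) ^ d * X) - (L : ℝ) ^ (d + 1) * X) + Pq) - ((N : ℝ) ^ (d + 1))⁻¹ * ∑' c : Site (d + 1), ∑ κ, ψ (c + unitVec κ) * T κ c * M κ c
      = r * (A + B + C) - r * (((L : ℝ) ^ (d + 1) - (L : ℝ) ^ d) * X) := by
    rw [← hread]; ring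
  rw [htsum, e]
  -- the three pointwise terms
  have hA' : |A| ≤ ((d : ℝ) + 1) * (Eψ * Real.exp κ₀) * ε₁ * E₃ * ((N' : ℝ) ^ (d + 1) * ZE) := hA.trans (le_of_eq (by rw [hZE]; ring))
  have hB' : |B| ≤ ((d : ℝ) + 1) * (Eψ * Real.exp κ₀) * E₁ * ε₃ * ((N' : ℝ) ^ (d + 1) * ZE) := hB.trans (le_of_eq (by rw [hZE]; ring))
  have hC' : |C| ≤ ((d : ℝ) + 1) * (εψ * Real.exp κ₀) * E₁ * E₃ * ((N' : ℝ) ^ (d + 1) * ZE) := hC.trans (le_of_eq (by rw [hZE]; ring))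
  have h3 := abs_add_three A B C
  have hK₁ : |r * (A + B + C)| ≤ ((d : ℝ) + 1) * (Real.exp κ₀ * (Eψ * ε₁ * E₃ + Eψ * E₁ * ε₃ + εψ * E₁ * E₃)) * ZE := by
    rw [abs_mul, abs_of_nonneg hr0]
    have hsum : |A| + |B| + |C| ≤ ((d : ℝ) + 1) * (Real.exp κ₀ * (Eψ * ε₁ * E₃ + Eψ * E₁ * ε₃ + εψ * E₁ * E₃)) * ((N' : ℝ) ^ (d + 1) * ZE) := by
      have eq : ((d : ℝ) + 1) * (Real.exp κ₀ * (Eψ * ε₁ * E₃ + Eψ * E₁ * ε₃ + εψ * E₁ * E₃)) * ((N' : ℝ) ^ (d + 1) * ZE)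
          = ((d : ℝ) + 1) * (Eψ * Real.exp κ₀) * ε₁ * E₃ * ((N' : ℝ) ^ (d + 1) * ZE)
            + ((d : ℝ) + 1) * (Eψ * Real.exp κ₀) * E₁ * ε₃ * ((N' : ℝ) ^ (d + 1) * ZE)
            + ((d : ℝ) + 1) * (εψ * Real.exp κ₀) * E₁ * E₃ * ((N' : ℝ) ^ (d + 1) * ZE) := by ring
      rw [eq]; linarith
    calc r * |A + B + C| ≤ r * (((d : ℝ) + 1) * (Real.exp κ₀ * (Eψ * ε₁ * E₃ + Eψ * E₁ * ε₃ + εψ * E₁ * E₃)) * ((N' : ℝ) ^ (d + 1) * ZE)) :=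
          mul_le_mul_of_nonneg_left (h3.trans hsum) hr0
      _ = ((d : ℝ) + 1) * (Real.exp κ₀ * (Eψ * ε₁ * E₃ + Eψ * E₁ * ε₃ + εψ * E₁ * E₃)) * ZE * (r * (N' : ℝ) ^ (d + 1)) := by ring
      _ = _ := by rw [hrN', mul_one]
  -- the realignment term
  have hK₂ : |r * (((L : ℝ) ^ (d + 1) - (L : ℝ) ^ d) * X)| ≤
      ((d : ℝ) + 1) * (2 * Real.exp κ₀ * (∑ s ∈ Finset.range (k + 1), a s * ((P s : ℝ))⁻¹) * (E₁ * E₃)) * ZE := by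
    have hLd : 0 ≤ (L : ℝ) ^ (d + 1) - (L : ℝ) ^ d := by
      rw [pow_succ]; nlinarith [pow_nonneg (zero_le_one.trans hL1) d]
    have hLd' : (L : ℝ) ^ (d + 1) - (L : ℝ) ^ d ≤ (L : ℝ) ^ (d + 1) := by
      have := pow_nonneg (zero_le_one.trans hL1) d; linarith
    rw [abs_mul, abs_mul, abs_of_nonneg hr0, abs_of_nonneg hLd]
    have hX' : |X| ≤ ((d : ℝ) + 1) * (2 * Real.exp κ₀) * (E₁ * E₃) * (∑ s ∈ Finset.range (k + 1), a s * ((P s : ℝ))⁻¹) * ((N : ℝ) ^ (d + 1) * ZE) :=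
      hX.trans (le_of_eq (by rw [hZE]; ring))
    calc r * (((L : ℝ) ^ (d + 1) - (L : ℝ) ^ d) * |X|)
        ≤ r * ((L : ℝ) ^ (d + 1) * (((d : ℝ) + 1) * (2 * Real.exp κ₀) * (E₁ * E₃) * (∑ s ∈ Finset.range (k + 1), a s * ((P s : ℝ))⁻¹) *
            ((N : ℝ) ^ (d + 1) * ZE))) :=
          mul_le_mul_of_nonneg_left (mul_le_mul hLd' hX' (abs_nonneg X) (by positivity)) hr0
      _ = ((d : ℝ) + 1) * (2 * Real.exp κ₀ * (∑ s ∈ Finset.range (k + 1), a s * ((P s : ℝ))⁻¹) * (E₁ * E₃)) * ZE *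
            (r * ((L : ℝ) ^ (d + 1) * (N : ℝ) ^ (d + 1))) := by ring
      _ = _ := by rw [← hpow, hrN', mul_one]
  have htri := abs_sub (r * (A + B + C)) (r * (((L : ℝ) ^ (d + 1) - (L : ℝ) ^ d) * X))
  have eq : ((d : ℝ) + 1) * (Real.exp κ₀ * (Eψ * ε₁ * E₃ + Eψ * E₁ * ε₃ + εψ * E₁ * E₃)
          + 2 * Real.exp κ₀ * (∑ s ∈ Finset.range (k + 1), a s * ((P s : ℝ))⁻¹) * (E₁ * E₃)) * ZE
      = ((d : ℝ) + 1) * (Real.exp κ₀ * (Eψ * ε₁ * E₃ + Eψ * E₁ * ε₃ + εψ * E₁ * E₃)) * ZE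
        + ((d : ℝ) + 1) * (2 * Real.exp κ₀ * (∑ s ∈ Finset.range (k + 1), a s * ((P s : ℝ))⁻¹) * (E₁ * E₃)) * ZE := by ring
  rw [eq]
  linarith

/-- NOT IN PRINT; OUR BOOKKEEPING.  **THE TWO-TOWER DIFFERENCE OF A MAXWELL PAIRING WITH MIDPOINT WEIGHTS** (the second pairing of `cell_eq`:
`Σ'_z Σ_β ½(ψ z + ψ(z + e_β))·T β z·M β z`) — half the SITE comparison (PART 1's `abs_refine3_le`, no realignment) plus half the TIP comparison
(`abs_refine3_tip_le`); stated with the tip bound (`1 ≤ e^{κ₀}`). -/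
theorem abs_refine3_mid_le (hL : 1 ≤ L) (hN : 1 ≤ N) (hN' : N' = L * N) (hκ : 0 < κ₀)
    (hEψ : 0 ≤ Eψ) (hE₁ : 0 ≤ E₁) (hE₃ : 0 ≤ E₃) (hεψ : 0 ≤ εψ) (hε₁ : 0 ≤ ε₁) (hε₃ : 0 ≤ ε₃) (ha : ∀ s, 0 ≤ a s)
    (hP : ∀ s, s ≤ k → 1 ≤ P s) (hPN : ∀ s, s ≤ k → P s ∣ N)
    (hψ' : ∀ x, |ψ' x| ≤ Eψ * Real.exp (-(κ₀ * supNorm (quo N' x - z₀))))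
    (hψ : ∀ c, |ψ c| ≤ Eψ * Real.exp (-(κ₀ * supNorm (quo N c - z₀))))
    (hG : ∀ s, s ≤ k → ∀ c, |G s (blk (P s) c)| ≤ a s * Real.exp (-(κ₀ * supNorm (quo N c - z₀))))
    (hψG : ∀ c, ψ c = ∑ s ∈ Finset.range (k + 1), G s (blk (P s) c))
    (hM' : ∀ κ x, |M' κ x| ≤ E₃ * Real.exp (-(κ₀ * supNorm (quo N' x - z₃))))
    (hT : ∀ κ c, |T κ c| ≤ E₁ * Real.exp (-(κ₀ * supNorm (quo N c - z₁))))
    (hM : ∀ κ c, |M κ c| ≤ E₃ * Real.exp (-(κ₀ * supNorm (quo N c - z₃))))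
    (hdT : ∀ κ x, |T' κ x - T κ (quo L x)| ≤ ε₁ * Real.exp (-(κ₀ * supNorm (quo N' x - z₁))))
    (hdM : ∀ κ x, |M' κ x - M κ (quo L x)| ≤ ε₃ * Real.exp (-(κ₀ * supNorm (quo N' x - z₃))))
    (hdψ : ∀ x, |ψ' x - ψ (quo L x)| ≤ εψ * Real.exp (-(κ₀ * supNorm (quo N' x - z₀)))) :
    (Summable fun x : Site (d + 1) => ∑ κ, (ψ' x + ψ' (x + unitVec κ)) / 2 * T' κ x * M' κ x) ∧
    (Summable fun c : Site (d + 1) => ∑ κ, (ψ c + ψ (c + unitVec κ)) / 2 * T κ c * M κ c) ∧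
    |((N' : ℝ) ^ (d + 1))⁻¹ * ∑' x : Site (d + 1), ∑ κ, (ψ' x + ψ' (x + unitVec κ)) / 2 * T' κ x * M' κ x -
        ((N : ℝ) ^ (d + 1))⁻¹ * ∑' c : Site (d + 1), ∑ κ, (ψ c + ψ (c + unitVec κ)) / 2 * T κ c * M κ c| ≤
      ((d : ℝ) + 1) * (Real.exp κ₀ * (Eψ * ε₁ * E₃ + Eψ * E₁ * ε₃ + εψ * E₁ * E₃)
          + 2 * Real.exp κ₀ * (∑ s ∈ Finset.range (k + 1), a s * ((P s : ℝ))⁻¹) * (E₁ * E₃)) *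
        (Zl (d + 1) (κ₀ / (4 * ((d : ℝ) + 1))) * Real.exp (-(κ₀ / 12) * (supNorm (z₁ - z₀) + supNorm (z₃ - z₀)))) := by
  obtain ⟨hsS', hsS, hS⟩ := abs_refine3_le (W' := fun _ x => ψ' x) (T' := T') (M' := M') (W := fun _ c => ψ c) (T := T) (M := M)
    (z₀ := z₀) (z₁ := z₁) (z₃ := z₃) hL hN hN' hκ hEψ hE₁ hE₃ hεψ hε₁ hε₃ (fun _ x => hψ' x) hM' (fun _ c => hψ c) hT hM hdT hdM (fun _ x => hdψ x)
  obtain ⟨hsT', hsT, hTip⟩ := abs_refine3_tip_le (ψ' := ψ') (ψ := ψ) (T' := T') (M' := M') (T := T) (M := M) (z₀ := z₀) (z₁ := z₁) (z₃ := z₃)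
    hL hN hN' hκ hEψ hE₁ hE₃ hεψ hε₁ hε₃ ha hP hPN hψ' hψ hG hψG hM' hT hM hdT hdM hdψ
  have hsplit' : ∀ x : Site (d + 1), ∑ κ, (ψ' x + ψ' (x + unitVec κ)) / 2 * T' κ x * M' κ x
      = (1 / 2 : ℝ) * (∑ κ, ψ' x * T' κ x * M' κ x) + (1 / 2 : ℝ) * ∑ κ, ψ' (x + unitVec κ) * T' κ x * M' κ x := by
    intro x; rw [Finset.mul_sum, Finset.mul_sum, ← Finset.sum_add_distrib]; exact Finset.sum_congr rfl fun κ _ => by ring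
  have hsplit : ∀ c : Site (d + 1), ∑ κ, (ψ c + ψ (c + unitVec κ)) / 2 * T κ c * M κ c
      = (1 / 2 : ℝ) * (∑ κ, ψ c * T κ c * M κ c) + (1 / 2 : ℝ) * ∑ κ, ψ (c + unitVec κ) * T κ c * M κ c := by
    intro c; rw [Finset.mul_sum, Finset.mul_sum, ← Finset.sum_add_distrib]; exact Finset.sum_congr rfl fun κ _ => by ring
  refine ⟨((hsS'.mul_left _).add (hsT'.mul_left _)).congr fun x => (hsplit' x).symm,
    ((hsS.mul_left _).add (hsT.mul_left _)).congr fun c => (hsplit c).symm, ?_⟩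
  rw [tsum_congr hsplit', tsum_congr hsplit, (hsS'.mul_left _).tsum_add (hsT'.mul_left _), (hsS.mul_left _).tsum_add (hsT.mul_left _),
    tsum_mul_left, tsum_mul_left, tsum_mul_left, tsum_mul_left]
  set ZE : ℝ := Zl (d + 1) (κ₀ / (4 * ((d : ℝ) + 1))) * Real.exp (-(κ₀ / 12) * (supNorm (z₁ - z₀) + supNorm (z₃ - z₀))) with hZE
  set S' : ℝ := ∑' x : Site (d + 1), ∑ κ, ψ' x * T' κ x * M' κ x
  set S : ℝ := ∑' c : Site (d + 1), ∑ κ, ψ c * T κ c * M κ c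
  set U' : ℝ := ∑' x : Site (d + 1), ∑ κ, ψ' (x + unitVec κ) * T' κ x * M' κ x
  set U : ℝ := ∑' c : Site (d + 1), ∑ κ, ψ (c + unitVec κ) * T κ c * M κ c
  have e : ((N' : ℝ) ^ (d + 1))⁻¹ * ((1 / 2 : ℝ) * S' + (1 / 2 : ℝ) * U') - ((N : ℝ) ^ (d + 1))⁻¹ * ((1 / 2 : ℝ) * S + (1 / 2 : ℝ) * U)
      = (1 / 2 : ℝ) * (((N' : ℝ) ^ (d + 1))⁻¹ * S' - ((N : ℝ) ^ (d + 1))⁻¹ * S)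
        + (1 / 2 : ℝ) * (((N' : ℝ) ^ (d + 1))⁻¹ * U' - ((N : ℝ) ^ (d + 1))⁻¹ * U) := by ring
  rw [e]
  have htri := abs_add_le ((1 / 2 : ℝ) * (((N' : ℝ) ^ (d + 1))⁻¹ * S' - ((N : ℝ) ^ (d + 1))⁻¹ * S))
    ((1 / 2 : ℝ) * (((N' : ℝ) ^ (d + 1))⁻¹ * U' - ((N : ℝ) ^ (d + 1))⁻¹ * U))
  rw [abs_mul, abs_mul, abs_of_pos (by norm_num : (0 : ℝ) < 1 / 2)] at htri
  -- the site bound is below the tip bound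
  have hZE0 : 0 ≤ ZE := by
    rw [hZE]
    have hc : 0 < κ₀ / (4 * ((d : ℝ) + 1)) := by positivity
    exact mul_nonneg (Zl_nonneg hc) (Real.exp_pos _).le
  have hx : (1 : ℝ) ≤ Real.exp κ₀ := Real.one_le_exp hκ.le
  have hsum0 : 0 ≤ ∑ s ∈ Finset.range (k + 1), a s * ((P s : ℝ))⁻¹ :=
    Finset.sum_nonneg fun s _ => mul_nonneg (ha s) (inv_nonneg.2 (Nat.cast_nonneg _))
  have hbase : 0 ≤ Eψ * ε₁ * E₃ + Eψ * E₁ * ε₃ + εψ * E₁ * E₃ := by positivity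
  have hS' : |((N' : ℝ) ^ (d + 1))⁻¹ * S' - ((N : ℝ) ^ (d + 1))⁻¹ * S| ≤
      ((d : ℝ) + 1) * (Real.exp κ₀ * (Eψ * ε₁ * E₃ + Eψ * E₁ * ε₃ + εψ * E₁ * E₃)
          + 2 * Real.exp κ₀ * (∑ s ∈ Finset.range (k + 1), a s * ((P s : ℝ))⁻¹) * (E₁ * E₃)) * ZE := by
    refine hS.trans ?_
    have h1 : (Eψ * ε₁ * E₃ + Eψ * E₁ * ε₃ + εψ * E₁ * E₃) ≤ Real.exp κ₀ * (Eψ * ε₁ * E₃ + Eψ * E₁ * ε₃ + εψ * E₁ * E₃)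
        + 2 * Real.exp κ₀ * (∑ s ∈ Finset.range (k + 1), a s * ((P s : ℝ))⁻¹) * (E₁ * E₃) := by
      have h2 : 0 ≤ 2 * Real.exp κ₀ * (∑ s ∈ Finset.range (k + 1), a s * ((P s : ℝ))⁻¹) * (E₁ * E₃) := by positivity
      nlinarith
    have hd : (0 : ℝ) ≤ (d : ℝ) + 1 := by positivity
    exact mul_le_mul_of_nonneg_right (mul_le_mul_of_nonneg_left h1 hd) hZE0
  linarith

end Tip

end Summit.QuantumFields.BalabanUV.Beta.GAN24.ContactCellRefineTip

end
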